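import Literature.Topology.FourManifolds.CappellShanesonClassGroupSeventyfiveMain
import HarnessLib

/-!
# Trace `75`: Gompf's conjecture REDUCED to Iwaki's two undecided special classes `(101, 163, 75)` and `(31, 197, 75)`

The trace `75` is covered neither by Kim–Yamada's Theorem B (`[-64, 69]`, tree: `CappellShanesonThmBWindow.lean`)
nor by Iwaki's Theorem 5.1 (`-73, -69, -67, -66, 71, 72, 74, 78`, tree: `CappellShanesonIwakiWindow.lean`).  K. Iwaki,
*Infinite families of standard Cappell–Shaneson homotopy 4-spheres*, Topology Appl. 366 (2025) 109293 =
arXiv:2404.05096, §4.3 lists the `24` ideal classes of `ℤ[θ₇₅]` (MAGMA; certified in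
`…ClassGroupSeventyfive{,Rel1,Rel2,Rel3,Cls,Main}.lean`), and §5.1 explains the procedure behind Theorem 5.1: a
representative `(c, d, n)` with `n ≡ n₀ (mod d)` for a trace `n₀` where Gompf's conjecture is known moves to `A₀` by one
Gompf move (Lemma 5.2 = Kim–Yamada's Lemma 6.1); the remaining, "special", classes are treated one by one by printed
chains — none of which concerns the trace `75` ("if it is uncertain whether or not a special `(c,d,n)` is equivalent to
`(1,1,2)`, such `(c,d,n)` are double underlined").  For the row `n = 75` exactly two classes are special:
`(101, 163, 75)` and `(31, 197, 75)` (a Gompf move changes the trace by a multiple of `d`; the nearest candidates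
`75 - 163 = -88` and `75 - 197 = -122` are not among the traces where the conjecture is known).  This file runs the
procedure over the certified cover `isConj_standardCSMatrix_of_trace_eq_seventyfive` and proves:

* `gompfConjectureForTrace_seventyfive_of` — the inductive-step form (hypotheses: Gompf's conjecture at the smaller
  traces met by the moves, all theorems of the tree, and the Gompf equivalence of the two special standard matrices
  with `A₀`);
* `gompfConjectureForTrace_seventyfive_of_undecided` — **`GompfConjectureForTrace 75` from the two undecided classes
  alone**, and `gompfConjectureForTrace_seventyfive_iff` (the converse is trivial); the mirror `-70 = 5 - 75` by
  Kim–Yamada's Theorem A (`gompfConjectureForTrace_neg_seventy_of_undecided`).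

Nothing here decides the two classes; no named fact is introduced (D-0026).  (File generated by the seat's
`gen_main.py` ∕ `splitN.py` with the open-class hypotheses, lit-hodgefound p15, 2026-08-28.)

## References
* [Iwaki2025] K. Iwaki, Topology Appl. 366 (2025) 109293 (arXiv:2404.05096): §4.3 (Table, row `n = 75`: `24` classes),
  §5.1 (Lemma 5.2, the special classes; no chain for the trace `75`), Thm. 5.1 (the known traces).
* [KimYamada2023] M. H. Kim, S. Yamada, Kyungpook Math. J. 63 (2023) 373–411: Lemma 6.1, Thm. A, Prop. 2.14.
-/

noncomputable section

open Set Polynomial Module NumberField Ideal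
open scoped NumberField MatrixGroups nonZeroDivisors
open Literature.LinearAlgebra.Matrix

namespace Literature.Topology.FourManifolds

section Gompf

/-- **Gompf's conjecture for the trace `75`, inductive step by Iwaki's procedure (Lemma 5.2 = Kim–Yamada's Lemma 6.1), CONDITIONAL** (granted the
conjecture for the traces `26`, `-12`, `-52`, `-18`, `-32`, `-38`, `16` and the Gompf equivalence with `A₀` of the standard matrices of the undecided classes `(101, 163, 75)`, `(31, 197, 75)`): the non-trivial classes move by Gompf moves to the traces
`-2` (from `(3, 7, 75)`), `26` (from `(38, 49, 75)`), `-12` (from `(11, 29, 75)`), `-52` (from `(49, 127, 75)`), `-18` (from `(13, 31, 75)`), `0` (from `(22, 25, 75)`), `-52` (from `(50, 127, 75)`), `-3` (from `(6, 13, 75)`), `-12` (from `(2, 29, 75)`), (UNDECIDED: `(101, 163, 75)`, hypothesis), `-7` (from `(26, 41, 75)`), `-12` (from `(4, 29, 75)`), `-52` (from `(103, 127, 75)`), (UNDECIDED: `(31, 197, 75)`, hypothesis), `0` (from `(2, 5, 75)`), `5` (from `(17, 35, 75)`), `-32` (from `(42, 107, 75)`), `1` (from `(34, 37, 75)`), `8`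 (from `(14, 67, 75)`), `-38` (from `(21, 113, 75)`), `-18` (from `(22, 31, 75)`), `-18` (from `(9, 31, 75)`), `16` (from `(40, 59, 75)`). [cite: Iwaki2025, §4.3 (Table, row n = 75) and §5.1 (Lemma 5.2; no chain is printed for the trace 75)] [cite: KimYamada2023, Lemma 6.1] -/
theorem gompfConjectureForTrace_seventyfive_of
    (h26 : GompfConjectureForTrace (26))
    (hneg12 : GompfConjectureForTrace (-12))
    (hneg52 : GompfConjectureForTrace (-52))
    (hneg18 : GompfConjectureForTrace (-18))
    (hneg32 : GompfConjectureForTrace (-32))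
    (hneg38 : GompfConjectureForTrace (-38))
    (h16 : GompfConjectureForTrace (16))
    (hX_101_163 : ∀ h : (163 : ℤ) ∣ (csPoly 75).eval 101, GompfEquiv (standardCSMatrix 101 163 75 h) akbulutKirbyMatrix)
    (hX_31_197 : ∀ h : (197 : ℤ) ∣ (csPoly 75).eval 31, GompfEquiv (standardCSMatrix 31 197 75 h) akbulutKirbyMatrix) : GompfConjectureForTrace 75 := by
  intro A hdet htr
  rcases isConj_standardCSMatrix_of_trace_eq_seventyfive A hdet htr with hc0 | hc1 | hc2 | hc3 | hc4 | hc5 | hc6 | hc7 | hc8 | hc9 | hc10 | hc11 | hc12 | hc13 | hc14 | hc15 | hc16 | hc17 | hc18 | hc19 | hc20 | hc21 | hc22 | hc23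
  · exact (GompfEquiv.of_isConj hc0).trans (gompfEquiv_standardCSMatrix_one_one 73 (one_dvd _))
  · exact (GompfEquiv.of_isConj hc1).trans
      (gompfEquiv_standardCSMatrix_akbulutKirbyMatrix_of_modEq
        (gompfConjectureForTrace_of_mem_Icc_neg_seven_twelve (by norm_num)) rep0_dvd_eval_csPoly_seventyfive
        (show (75 : ℤ) ≡ -2 [ZMOD 7] by decide))
  · exact (GompfEquiv.of_isConj hc2).trans
      (gompfEquiv_standardCSMatrix_akbulutKirbyMatrix_of_modEq
        h26 rep1_dvd_eval_csPoly_seventyfive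
        (show (75 : ℤ) ≡ 26 [ZMOD 49] by decide))
  · exact (GompfEquiv.of_isConj hc3).trans
      (gompfEquiv_standardCSMatrix_akbulutKirbyMatrix_of_modEq
        hneg12 rep2_dvd_eval_csPoly_seventyfive
        (show (75 : ℤ) ≡ -12 [ZMOD 29] by decide))
  · exact (GompfEquiv.of_isConj hc4).trans
      (gompfEquiv_standardCSMatrix_akbulutKirbyMatrix_of_modEq
        hneg52 rep3_dvd_eval_csPoly_seventyfive
        (show (75 : ℤ) ≡ -52 [ZMOD 127] by decide))
  · exact (GompfEquiv.of_isConj hc5).trans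
      (gompfEquiv_standardCSMatrix_akbulutKirbyMatrix_of_modEq
        hneg18 rep4_dvd_eval_csPoly_seventyfive
        (show (75 : ℤ) ≡ -18 [ZMOD 31] by decide))
  · exact (GompfEquiv.of_isConj hc6).trans
      (gompfEquiv_standardCSMatrix_akbulutKirbyMatrix_of_modEq
        (gompfConjectureForTrace_of_mem_Icc_neg_seven_twelve (by norm_num)) rep5_dvd_eval_csPoly_seventyfive
        (show (75 : ℤ) ≡ 0 [ZMOD 25] by decide))
  · exact (GompfEquiv.of_isConj hc7).trans
      (gompfEquiv_standardCSMatrix_akbulutKirbyMatrix_of_modEq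
        hneg52 rep6_dvd_eval_csPoly_seventyfive
        (show (75 : ℤ) ≡ -52 [ZMOD 127] by decide))
  · exact (GompfEquiv.of_isConj hc8).trans
      (gompfEquiv_standardCSMatrix_akbulutKirbyMatrix_of_modEq
        (gompfConjectureForTrace_of_mem_Icc_neg_seven_twelve (by norm_num)) rep7_dvd_eval_csPoly_seventyfive
        (show (75 : ℤ) ≡ -3 [ZMOD 13] by decide))
  · exact (GompfEquiv.of_isConj hc9).trans
      (gompfEquiv_standardCSMatrix_akbulutKirbyMatrix_of_modEq
        hneg12 rep8_dvd_eval_csPoly_seventyfive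
        (show (75 : ℤ) ≡ -12 [ZMOD 29] by decide))
  · exact (GompfEquiv.of_isConj hc10).trans (hX_101_163 _)
  · exact (GompfEquiv.of_isConj hc11).trans
      (gompfEquiv_standardCSMatrix_akbulutKirbyMatrix_of_modEq
        (gompfConjectureForTrace_of_mem_Icc_neg_seven_twelve (by norm_num)) rep10_dvd_eval_csPoly_seventyfive
        (show (75 : ℤ) ≡ -7 [ZMOD 41] by decide))
  · exact (GompfEquiv.of_isConj hc12).trans
      (gompfEquiv_standardCSMatrix_akbulutKirbyMatrix_of_modEq
        hneg12 rep11_dvd_eval_csPoly_seventyfive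
        (show (75 : ℤ) ≡ -12 [ZMOD 29] by decide))
  · exact (GompfEquiv.of_isConj hc13).trans
      (gompfEquiv_standardCSMatrix_akbulutKirbyMatrix_of_modEq
        hneg52 rep12_dvd_eval_csPoly_seventyfive
        (show (75 : ℤ) ≡ -52 [ZMOD 127] by decide))
  · exact (GompfEquiv.of_isConj hc14).trans (hX_31_197 _)
  · exact (GompfEquiv.of_isConj hc15).trans
      (gompfEquiv_standardCSMatrix_akbulutKirbyMatrix_of_modEq
        (gompfConjectureForTrace_of_mem_Icc_neg_seven_twelve (by norm_num)) rep14_dvd_eval_csPoly_seventyfive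
        (show (75 : ℤ) ≡ 0 [ZMOD 5] by decide))
  · exact (GompfEquiv.of_isConj hc16).trans
      (gompfEquiv_standardCSMatrix_akbulutKirbyMatrix_of_modEq
        (gompfConjectureForTrace_of_mem_Icc_neg_seven_twelve (by norm_num)) rep15_dvd_eval_csPoly_seventyfive
        (show (75 : ℤ) ≡ 5 [ZMOD 35] by decide))
  · exact (GompfEquiv.of_isConj hc17).trans
      (gompfEquiv_standardCSMatrix_akbulutKirbyMatrix_of_modEq
        hneg32 rep16_dvd_eval_csPoly_seventyfive
        (show (75 : ℤ) ≡ -32 [ZMOD 107] by decide))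
  · exact (GompfEquiv.of_isConj hc18).trans
      (gompfEquiv_standardCSMatrix_akbulutKirbyMatrix_of_modEq
        (gompfConjectureForTrace_of_mem_Icc_neg_seven_twelve (by norm_num)) rep17_dvd_eval_csPoly_seventyfive
        (show (75 : ℤ) ≡ 1 [ZMOD 37] by decide))
  · exact (GompfEquiv.of_isConj hc19).trans
      (gompfEquiv_standardCSMatrix_akbulutKirbyMatrix_of_modEq
        (gompfConjectureForTrace_of_mem_Icc_neg_seven_twelve (by norm_num)) rep18_dvd_eval_csPoly_seventyfive
        (show (75 : ℤ) ≡ 8 [ZMOD 67] by decide))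
  · exact (GompfEquiv.of_isConj hc20).trans
      (gompfEquiv_standardCSMatrix_akbulutKirbyMatrix_of_modEq
        hneg38 rep19_dvd_eval_csPoly_seventyfive
        (show (75 : ℤ) ≡ -38 [ZMOD 113] by decide))
  · exact (GompfEquiv.of_isConj hc21).trans
      (gompfEquiv_standardCSMatrix_akbulutKirbyMatrix_of_modEq
        hneg18 rep20_dvd_eval_csPoly_seventyfive
        (show (75 : ℤ) ≡ -18 [ZMOD 31] by decide))
  · exact (GompfEquiv.of_isConj hc22).trans
      (gompfEquiv_standardCSMatrix_akbulutKirbyMatrix_of_modEq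
        hneg18 rep21_dvd_eval_csPoly_seventyfive
        (show (75 : ℤ) ≡ -18 [ZMOD 31] by decide))
  · exact (GompfEquiv.of_isConj hc23).trans
      (gompfEquiv_standardCSMatrix_akbulutKirbyMatrix_of_modEq
        h16 rep22_dvd_eval_csPoly_seventyfive
        (show (75 : ℤ) ≡ 16 [ZMOD 59] by decide))

/-- **The trace `-70`** (`= 5 - 75`), by Kim–Yamada's Theorem A, under the same hypotheses. [cite: KimYamada2023, Thm. A] [cite: Iwaki2025, §5.1] -/
theorem gompfConjectureForTrace_neg_seventy_of
    (h26 : GompfConjectureForTrace (26))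
    (hneg12 : GompfConjectureForTrace (-12))
    (hneg52 : GompfConjectureForTrace (-52))
    (hneg18 : GompfConjectureForTrace (-18))
    (hneg32 : GompfConjectureForTrace (-32))
    (hneg38 : GompfConjectureForTrace (-38))
    (h16 : GompfConjectureForTrace (16))
    (hX_101_163 : ∀ h : (163 : ℤ) ∣ (csPoly 75).eval 101, GompfEquiv (standardCSMatrix 101 163 75 h) akbulutKirbyMatrix)
    (hX_31_197 : ∀ h : (197 : ℤ) ∣ (csPoly 75).eval 31, GompfEquiv (standardCSMatrix 31 197 75 h) akbulutKirbyMatrix) : GompfConjectureForTrace (-70) := by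
  have h := gompfConjectureForTrace_of_five_sub (gompfConjectureForTrace_seventyfive_of h26 hneg12 hneg52 hneg18 hneg32 hneg38 h16 hX_101_163 hX_31_197)
  norm_num at h
  exact h

/-- **Gompf's conjecture for the trace `75` from Iwaki's two undecided classes alone**: every smaller-trace
hypothesis of `gompfConjectureForTrace_seventyfive_of` is a theorem of the tree
(`gompfConjectureForTrace_twentysix`, `gompfConjectureForTrace_neg_twelve`, `gompfConjectureForTrace_neg_fiftytwo`, `gompfConjectureForTrace_neg_eighteen`, `gompfConjectureForTrace_neg_thirtytwo`, `gompfConjectureForTrace_neg_thirtyeight`, `gompfConjectureForTrace_sixteen`), so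
`GompfConjectureForTrace 75` follows from `X_{101,163,75} ∼ A₀`, `X_{31,197,75} ∼ A₀` (the two special
classes of the trace `75`, Iwaki 2025, §4.3 ∕ §5.1, for which no chain is printed). [cite: Iwaki2025, §5.1 and §4.3 (Table, row 75)] -/
theorem gompfConjectureForTrace_seventyfive_of_undecided
    (h₁ : ∀ h : (163 : ℤ) ∣ (csPoly 75).eval 101, GompfEquiv (standardCSMatrix 101 163 75 h) akbulutKirbyMatrix)
    (h₂ : ∀ h : (197 : ℤ) ∣ (csPoly 75).eval 31, GompfEquiv (standardCSMatrix 31 197 75 h) akbulutKirbyMatrix) :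
    GompfConjectureForTrace 75 :=
  gompfConjectureForTrace_seventyfive_of gompfConjectureForTrace_twentysix gompfConjectureForTrace_neg_twelve gompfConjectureForTrace_neg_fiftytwo gompfConjectureForTrace_neg_eighteen gompfConjectureForTrace_neg_thirtytwo gompfConjectureForTrace_neg_thirtyeight gompfConjectureForTrace_sixteen h₁ h₂

/-- **The trace `-70 = 5 - 75` from the same two classes**, by Kim–Yamada's Theorem A. [cite: KimYamada2023, Thm. A] [cite: Iwaki2025, §5.1] -/
theorem gompfConjectureForTrace_neg_seventy_of_undecided
    (h₁ : ∀ h : (163 : ℤ) ∣ (csPoly 75).eval 101, GompfEquiv (standardCSMatrix 101 163 75 h) akbulutKirbyMatrix)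
    (h₂ : ∀ h : (197 : ℤ) ∣ (csPoly 75).eval 31, GompfEquiv (standardCSMatrix 31 197 75 h) akbulutKirbyMatrix) :
    GompfConjectureForTrace (-70) :=
  gompfConjectureForTrace_neg_seventy_of gompfConjectureForTrace_twentysix gompfConjectureForTrace_neg_twelve gompfConjectureForTrace_neg_fiftytwo gompfConjectureForTrace_neg_eighteen gompfConjectureForTrace_neg_thirtytwo gompfConjectureForTrace_neg_thirtyeight gompfConjectureForTrace_sixteen h₁ h₂

/-- **Gompf's conjecture for the trace `75` ⟺ the two undecided standard matrices `X_{101,163,75}`, `X_{31,197,75}`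
are Gompf equivalent to `A₀`** (⇒ is the conjecture applied to these matrices,
`GompfConjectureForTrace.standardCSMatrix`). [cite: Iwaki2025, §5.1 and §4.3 (Table, row 75)] -/
theorem gompfConjectureForTrace_seventyfive_iff :
    GompfConjectureForTrace 75 ↔
      (∀ h : (163 : ℤ) ∣ (csPoly 75).eval 101, GompfEquiv (standardCSMatrix 101 163 75 h) akbulutKirbyMatrix) ∧
        ∀ h : (197 : ℤ) ∣ (csPoly 75).eval 31, GompfEquiv (standardCSMatrix 31 197 75 h) akbulutKirbyMatrix :=
  ⟨fun hG => ⟨fun h => hG.standardCSMatrix h, fun h => hG.standardCSMatrix h⟩,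
    fun h => gompfConjectureForTrace_seventyfive_of_undecided h.1 h.2⟩

/-- **`(101, 163, 75)`, `(31, 197, 75)` are Cappell–Shaneson triples** (`163 ∣ f₇₅(101)`, `197 ∣ f₇₅(31)`):
the two undecided standard matrices exist. [cite: Iwaki2025, §4.3 (Table, row 75)] -/
theorem dvd_eval_csPoly_seventyfive_undecided :
    (163 : ℤ) ∣ (csPoly 75).eval 101 ∧ (197 : ℤ) ∣ (csPoly 75).eval 31 := by
  refine ⟨?_, ?_⟩ <;> norm_num [eval_csPoly]

end Gompf

end Literature.Topology.FourManifolds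

end
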